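/-
Copyright: the b2b-balaban T⁴-continuum CRUX team, row NE7b leaf lineage `t4-ne7b-formalise-leaf-04` (gen 154). Project licence.
-/
import Mathlib.Analysis.Calculus.FDeriv.Comp
import Mathlib.Analysis.Calculus.FDeriv.CompCLM
import Mathlib.Analysis.Calculus.FDeriv.Congr
import Mathlib.Analysis.Calculus.FDeriv.Const
import Mathlib.Analysis.Calculus.FDeriv.Linear
import Mathlib.Analysis.Normed.Operator.Bilinear

/-!
# THE VALUE SIDE OF THE NONLINEAR-CONSTRAINT HARD STEP ALONG A `C¹` KKT BRANCH: the multiplier IS the gradient of the next action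
# (`(V ∘ δ)′(w) = λ(w)`), the next Hessian IS the multiplier's derivative (`(V ∘ δ)″(w) = λ′(w)`), and its graph formula is the
# LAGRANGIAN form transported along `δ′` (`λ′(w) k k′ = (V″ − λ(w) ∘ G″)(δ(w)) (δ′k) (δ′k′)`) — the KKT twin of
# `…HardStepActionHessian` (HSAH), Mathlib only
# (row NE7b, node U5c; the NOT-HERE «value side … KKT twins not typed» of leaf-03's `…HardStepKKTBranch` (HKB); TRANSFER row (xxiv):
# [B11] CMP 102 p. 305 «U_k = U_k(V) … an analytic function of B», p. 307 (182)–(190); [B12] CMP 109 (0.17) the HARD `δ(Ū(c)V⁻¹(c))`,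
# a NONLINEAR averaging constraint; [folklore] — the first- and second-order envelope theorem along a `C¹` primal–dual branch)

Cell `pub-balaban`, sub-cell `t4`, spine estimate NE7b (`T4WeightBudget.RelWeightBound`; the cell's OWN estimate — NOT PRINTED
in [Bałaban 1983–89], NOT PROVED).  Crux-route work under `Spine/NE7b/` by leaf-04 (CRUX team (2), FREEZE (0) crux-prover clause).
NOTHING of Bałaban's is named, asserted, valued or discharged; no `T4Continuum/Support` leaf typed; no `def`; zero `sorry`.  Imports
Mathlib ONLY (chain rule, `HasFDerivAt.clm_comp`, `compL`) — independent of the `Spine/NE7b` olean frontier; the conclusions of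
leaf-03's `…AugmentedLagrangianEquivalence` (ALE) ∕ `…KKTChartDerivative` (KCD) ∕ `…HardStepKKTBranch` (HKB) and of this lineage's
`…HardStepChartRadius` (HSCR) ∕ `…HardStepBranchDeriv` (HSBD) enter as displayed hypotheses — letters in, letters out; nothing of
them, of HSAH, or of leaf-03's `…ConstrainedValueLagrangian` (CVL) is imported or restated.

WHY.  For a LINEAR constraint `D δ = w` the chain AHE → HSCR → HSBD → HSBDM → HSAH → HSTL types the hard step's value side: HSAH
shows `(V ∘ σ)″(w) = V″(σ w)[σ′(w)·, σ′(w)·]` with `σ ∈ C¹` only.  Bałaban's averaging constraint is NONLINEAR ([B8] CMP 98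
(134)–(135): `Q_k(U₀, ηA) = Q_k(U₀)A + C_k(U₀, A)`; [B12] (0.17)), and for a nonlinear constraint `G δ = w` the critical points are
the KKT pairs `(δ, λ)` with `DV(δ) = λ ∘ DG(δ)`.  Leaf-03's ALE ∕ KCD ∕ HKB produce the KKT branch `w ↦ (δ(w), λ(w))` on an explicit
ball, `C¹` with constants; HKB lists as NOT HERE «the value side (`V ∘ σ`'s derivatives … their KKT twins are not typed)».  CVL types
the value EXPANSION at the base point in Peano currency, deliberately WITHOUT an implicit function.  THIS FILE types the derivative
currency ALONG the branch, the KKT twin of HSAH: (i) differentiating the constraint `G(δ(w′)) = w′` gives `DG(δ w) ∘ δ′(w) = 1`; (ii)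
the chain rule and the KKT identity give `D(V ∘ δ)(w) = DV(δ w) ∘ δ′(w) = λ(w) ∘ DG(δ w) ∘ δ′(w) = λ(w)` — THE MULTIPLIER IS THE
GRADIENT OF THE NEXT ACTION (first-order envelope theorem; no derivative of `λ` needed); (iii) hence `D(V ∘ δ) = λ` NEAR `w`, so
the next Hessian is `λ′(w)` as soon as `λ` is differentiable at `w` — `δ ∈ C¹` only, exactly as in HSAH; (iv) differentiating the
KKT identity `DV(δ w′) = λ(w′) ∘ DG(δ w′)` at `w` (product rule for `comp`) and testing on a graph direction `δ′(w)k′` (where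
`DG(δ w)(δ′k′) = k′`) gives the GRAPH FORMULA `λ′(w) k k′ = V″(δ w)(δ′k)(δ′k′) − λ(w)(G″(δ w)(δ′k)(δ′k′))` — the LAGRANGIAN form
`V″ − λ ∘ G″` (ALE ∕ HKB's `P₀ − postcomp λ₀ ∘ C₀`, now at the moving point) transported along `δ′`; (v) so a floor `m` of the
Lagrangian form on the graph directions and `‖DG(δ w)‖ ≤ q` give the next floor `m∕q²`, and `‖(V ∘ δ)″(w)‖ ≤ ‖𝓛‖·‖δ′(w)‖²` — HSAH's
two-sided letters with `V″` replaced by the Lagrangian form.  No symmetry, no convexity, no minimality, no finite dimension.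

WHAT IS PROVED ([folklore]; the envelope ∕ second-order sensitivity theorem, e.g. Bonnans–Shapiro, *Perturbation Analysis of
Optimization Problems* (2000) §4.7 and §5.1, Fiacco (1983) §3.2 — there for minimisers in finite dimension; here for `C¹` KKT branches in
normed spaces; nothing cited as a fact; nearest tree items: HSAH (linear constraint), CVL (Peano, base point), HKB (produces the branch)).
Letters: `G : E → F`, `V : E → ℝ`, a primal branch `δ : F → E`, a dual branch `lam : F → (F →L ℝ)`; pointwise families `Gd : E → E →L F`
(`DG`), `δd : F → F →L E` (`δ′`); on a set `s`: `G (δ w′) = w′`, `HasFDerivAt G (Gd (δ w′)) (δ w′)`, `HasFDerivAt δ (δd w′) w′`,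
`DifferentiableAt V (δ w′)`, KKT `fderiv V (δ w′) = (lam w′) ∘ Gd (δ w′)`.
* §1 `comp_branchDeriv_eq_id` (`s ∈ 𝓝 w` ⟹ `Gd (δ w) ∘ δd w = 1`), `apply_branchDeriv` (`Gd (δ w) (δd w k) = k`).
* §2 FIRST ORDER **`hasFDerivAt_comp_kktBranch`** (`HasFDerivAt (V ∘ δ) (lam w) w` — letters AT `w` plus the constraint near `w`),
  `fderiv_comp_kktBranch` (`fderiv (V ∘ δ) w = lam w`).
* §3 SECOND ORDER **`hasFDerivAt_fderiv_comp_kktBranch`** (letters on `s ∈ 𝓝 w`, `HasFDerivAt lam lam′ w` ⟹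
  `HasFDerivAt (fderiv (V ∘ δ)) lam′ w`), `fderiv_fderiv_comp_kktBranch`.
* §4 THE GRAPH FORMULA **`lagrangian_graph_formula`** (add `HasFDerivAt (fderiv V) V″ (δ w)`, `HasFDerivAt Gd Gdd (δ w)`:
  `lam′ k k′ = (V″ − (compL (lam w)) ∘ Gdd) (δd w k) (δd w k′)`), **`hessian_comp_kktBranch_apply`** (the same for
  `fderiv (fderiv (V ∘ δ)) w k k′`).
* §5 TWO-SIDED LETTERS **`floor_hessian_comp_kktBranch`** (`m‖v‖² ≤ 𝓛 v v` on graph directions, `0 ≤ m`, `0 < q`, `‖Gd (δ w) x‖ ≤ q‖x‖`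
  ⟹ `(m∕q²)‖k‖² ≤ (V ∘ δ)″(w) k k`), **`norm_hessian_comp_kktBranch_le`** (`‖(V ∘ δ)″(w)‖ ≤ ‖𝓛‖·‖δd w‖²`).
* §6 IN HKB's CONCLUSION SHAPE **`hasFDerivAt_fderiv_value_of_kktBranch`**: a primal–dual branch `σ : F → E × (F →L ℝ)` on `ball c ρ`
  with `G (σ w′).1 = w′`, KKT residual ZERO (`fderiv V (σ w′).1 = (σ w′).2 ∘ Gd (σ w′).1` — HKB at a KKT base point),
  `HasFDerivAt σ (S w′) w′` (HKB: `S w′ = A⁻¹ ∘ inl`) ⟹ `HasFDerivAt (fderiv (V ∘ (σ ·).1)) (snd ∘ S w) w` and the graph formula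
  with `δd w = fst ∘ S w`.
* §7 toys (`example`): the identity constraint on `ℝ` with `V = 0`; §1 on a concrete pair.

NOT HERE (honest): existence of the branch (HKB), its modulus (HSBDM's KKT twin — not typed), `C²` of `δ`; the identification of
`V ∘ δ` with the value function `inf {V δ : G δ = w}` (minimality — CVL's `isMinOn_fibre_of_firstOrderG` side); symmetry of `lam′(w)`
(equivalent to symmetry of the Lagrangian form on graph directions — automatic for symmetric `V″, G″`, not assumed); which
`V, G, δ, λ` and sizes are Bałaban's ((A3) ∕ (A1c), NC-NE7b-α UNRULED); anything of Bałaban's.  BY-NAME EFFECT ON THE WALL: NONE.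
NE7b NOT PRINTED ∕ NOT PROVED; spine PROVED 0∕9; rung (B)+1 on a FINITE torus — NOT infinite volume, NOT the mass gap, NOT Clay.
HONEST DEPENDENCY: continuum YM on T⁴ ⇐ BetaPertH ∧ nine spine estimates (0/9 proved); BetaPertH ⇐ (D1) ∧ (D4) ∧ CAP+tail;
G-an2-4 gates asym, D1 and NE2∕3∕4.
-/

set_option autoImplicit false

noncomputable section

namespace Summit.QuantumFields.BalabanUV.T4Continuum.NE7b.HardStepKKTActionHessian

open Set Filter Topology Function Metric

variable {E F : Type*} [NormedAddCommGroup E] [NormedSpace ℝ E] [NormedAddCommGroup F] [NormedSpace ℝ F]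

/-! ## §1. The constraint differentiated along the branch: `DG(δ w) ∘ δ′(w) = 1` -/

/-- **`DG(δ w) ∘ δ′(w) = 1`**: if `G (δ w′) = w′` for `w′` near `w`, `G` is differentiable at `δ w` with derivative `Gd` and `δ` at
`w` with derivative `δd`, then `Gd ∘ δd = id` (the chain rule for `G ∘ δ = id` near `w` and uniqueness of the derivative). [folklore] -/
theorem comp_branchDeriv_eq_id {G : E → F} {δ : F → E} {Gd : E →L[ℝ] F} {δd : F →L[ℝ] E} {s : Set F} {w : F}
    (hs : s ∈ 𝓝 w) (hGδ : ∀ w' ∈ s, G (δ w') = w') (hG : HasFDerivAt G Gd (δ w)) (hδ : HasFDerivAt δ δd w) :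
    Gd.comp δd = ContinuousLinearMap.id ℝ F := by
  have h1 : HasFDerivAt (G ∘ δ) (Gd.comp δd) w := hG.comp w hδ
  have h2 : HasFDerivAt (G ∘ δ) (ContinuousLinearMap.id ℝ F) w := by
    refine (hasFDerivAt_id w).congr_of_eventuallyEq ?_
    filter_upwards [hs] with w' hw'
    exact hGδ w' hw'
  exact h1.unique h2

/-- Pointwise form: `Gd (δd k) = k`. [folklore] -/
theorem apply_branchDeriv {G : E → F} {δ : F → E} {Gd : E →L[ℝ] F} {δd : F →L[ℝ] E} {s : Set F} {w : F}
    (hs : s ∈ 𝓝 w) (hGδ : ∀ w' ∈ s, G (δ w') = w') (hG : HasFDerivAt G Gd (δ w)) (hδ : HasFDerivAt δ δd w) (k : F) :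
    Gd (δd k) = k := by
  have h := congrArg (fun T : F →L[ℝ] F => T k) (comp_branchDeriv_eq_id hs hGδ hG hδ)
  simpa using h

/-- Hence `‖k‖ ≤ q·‖δd k‖` whenever `‖Gd x‖ ≤ q‖x‖`: the graph direction is at least `q⁻¹` times the kept one. [folklore] -/
theorem norm_le_mul_norm_branchDeriv {G : E → F} {δ : F → E} {Gd : E →L[ℝ] F} {δd : F →L[ℝ] E} {s : Set F} {w : F}
    (hs : s ∈ 𝓝 w) (hGδ : ∀ w' ∈ s, G (δ w') = w') (hG : HasFDerivAt G Gd (δ w)) (hδ : HasFDerivAt δ δd w)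
    {q : ℝ} (hGq : ∀ x : E, ‖Gd x‖ ≤ q * ‖x‖) (k : F) : ‖k‖ ≤ q * ‖δd k‖ := by
  have h := hGq (δd k)
  rwa [apply_branchDeriv hs hGδ hG hδ k] at h

/-! ## §2. First order: the multiplier is the gradient of the next action (envelope theorem) -/

/-- **`(V ∘ δ)′(w) = λ(w)`** — THE MULTIPLIER IS THE GRADIENT OF THE NEXT ACTION.  Letters AT `w`: `G` differentiable at `δ w` with
derivative `Gd`, `δ` at `w` with `δd`, `V` at `δ w`, the KKT identity `DV(δ w) = λ(w) ∘ Gd`; and the constraint `G (δ w′) = w′` near `w`.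
Then `HasFDerivAt (V ∘ δ) (lam w) w`: by the chain rule `D(V ∘ δ)(w) = DV(δ w) ∘ δd = λ(w) ∘ (Gd ∘ δd) = λ(w)` (§1).  No derivative of
`λ`, no second derivative of anything. [folklore] -/
theorem hasFDerivAt_comp_kktBranch {G : E → F} {V : E → ℝ} {δ : F → E} {lam : F → F →L[ℝ] ℝ} {Gd : E →L[ℝ] F}
    {δd : F →L[ℝ] E} {s : Set F} {w : F}
    (hs : s ∈ 𝓝 w) (hGδ : ∀ w' ∈ s, G (δ w') = w') (hG : HasFDerivAt G Gd (δ w)) (hδ : HasFDerivAt δ δd w)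
    (hV : DifferentiableAt ℝ V (δ w)) (hkkt : fderiv ℝ V (δ w) = (lam w).comp Gd) :
    HasFDerivAt (V ∘ δ) (lam w) w := by
  have hchain : HasFDerivAt (V ∘ δ) ((fderiv ℝ V (δ w)).comp δd) w := hV.hasFDerivAt.comp w hδ
  have hident : (fderiv ℝ V (δ w)).comp δd = lam w := by
    rw [hkkt, ContinuousLinearMap.comp_assoc, comp_branchDeriv_eq_id hs hGδ hG hδ, ContinuousLinearMap.comp_id]
  rw [← hident]
  exact hchain

/-- `fderiv` currency: `fderiv (V ∘ δ) w = lam w`. [folklore] -/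
theorem fderiv_comp_kktBranch {G : E → F} {V : E → ℝ} {δ : F → E} {lam : F → F →L[ℝ] ℝ} {Gd : E →L[ℝ] F}
    {δd : F →L[ℝ] E} {s : Set F} {w : F}
    (hs : s ∈ 𝓝 w) (hGδ : ∀ w' ∈ s, G (δ w') = w') (hG : HasFDerivAt G Gd (δ w)) (hδ : HasFDerivAt δ δd w)
    (hV : DifferentiableAt ℝ V (δ w)) (hkkt : fderiv ℝ V (δ w) = (lam w).comp Gd) :
    fderiv ℝ (V ∘ δ) w = lam w :=
  (hasFDerivAt_comp_kktBranch hs hGδ hG hδ hV hkkt).fderiv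

/-! ## §3. Second order: the next Hessian is the derivative of the multiplier (`δ ∈ C¹` only) -/

section SecondOrder

variable {G : E → F} {V : E → ℝ} {δ : F → E} {lam : F → F →L[ℝ] ℝ} {Gd : E → E →L[ℝ] F} {δd : F → F →L[ℝ] E}
  {s : Set F} {w : F}

/-- On the INTERIOR of `s` the first-order identity holds pointwise: `fderiv (V ∘ δ) w′ = lam w′`. [folklore] -/
theorem fderiv_comp_kktBranch_eventuallyEq (hs : s ∈ 𝓝 w) (hGδ : ∀ w' ∈ s, G (δ w') = w')
    (hG : ∀ w' ∈ s, HasFDerivAt G (Gd (δ w')) (δ w')) (hδ : ∀ w' ∈ s, HasFDerivAt δ (δd w') w')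
    (hV : ∀ w' ∈ s, DifferentiableAt ℝ V (δ w')) (hkkt : ∀ w' ∈ s, fderiv ℝ V (δ w') = (lam w').comp (Gd (δ w'))) :
    lam =ᶠ[𝓝 w] fderiv ℝ (V ∘ δ) := by
  filter_upwards [interior_mem_nhds.2 hs] with w' hw'
  have hs' : s ∈ 𝓝 w' := mem_interior_iff_mem_nhds.1 hw'
  have hw's : w' ∈ s := interior_subset hw'
  exact (fderiv_comp_kktBranch hs' hGδ (hG w' hw's) (hδ w' hw's) (hV w' hw's) (hkkt w' hw's)).symm

/-- **`(V ∘ δ)″(w) = λ′(w)`** — THE NEXT HESSIAN IS THE MULTIPLIER's DERIVATIVE.  Letters on `s ∈ 𝓝 w` (constraint, `DG`, `δ′`, `V`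
differentiable at `δ w′`, KKT) and `HasFDerivAt lam lam′ w` ⟹ `HasFDerivAt (fderiv ℝ (V ∘ δ)) lam′ w`.  Only ONE derivative of `δ`
is used (as in HSAH): near `w`, `fderiv (V ∘ δ) = lam` (§2), so the second derivative of the next action is whatever derivative the
dual branch has. [folklore] -/
theorem hasFDerivAt_fderiv_comp_kktBranch (hs : s ∈ 𝓝 w) (hGδ : ∀ w' ∈ s, G (δ w') = w')
    (hG : ∀ w' ∈ s, HasFDerivAt G (Gd (δ w')) (δ w')) (hδ : ∀ w' ∈ s, HasFDerivAt δ (δd w') w')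
    (hV : ∀ w' ∈ s, DifferentiableAt ℝ V (δ w')) (hkkt : ∀ w' ∈ s, fderiv ℝ V (δ w') = (lam w').comp (Gd (δ w')))
    {lam' : F →L[ℝ] F →L[ℝ] ℝ} (hlam : HasFDerivAt lam lam' w) :
    HasFDerivAt (fderiv ℝ (V ∘ δ)) lam' w :=
  hlam.congr_of_eventuallyEq (fderiv_comp_kktBranch_eventuallyEq hs hGδ hG hδ hV hkkt).symm

/-- `fderiv` currency: `fderiv (fderiv (V ∘ δ)) w = lam′`. [folklore] -/
theorem fderiv_fderiv_comp_kktBranch (hs : s ∈ 𝓝 w) (hGδ : ∀ w' ∈ s, G (δ w') = w')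
    (hG : ∀ w' ∈ s, HasFDerivAt G (Gd (δ w')) (δ w')) (hδ : ∀ w' ∈ s, HasFDerivAt δ (δd w') w')
    (hV : ∀ w' ∈ s, DifferentiableAt ℝ V (δ w')) (hkkt : ∀ w' ∈ s, fderiv ℝ V (δ w') = (lam w').comp (Gd (δ w')))
    {lam' : F →L[ℝ] F →L[ℝ] ℝ} (hlam : HasFDerivAt lam lam' w) :
    fderiv ℝ (fderiv ℝ (V ∘ δ)) w = lam' :=
  (hasFDerivAt_fderiv_comp_kktBranch hs hGδ hG hδ hV hkkt hlam).fderiv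

/-! ## §4. The graph formula: `λ′(w) k k′` is the LAGRANGIAN form `V″ − λ(w) ∘ G″` on the graph directions `δ′k, δ′k′` -/

/-- **THE KKT IDENTITY DIFFERENTIATED**: with `HasFDerivAt (fderiv V) V″ (δ w)` and `HasFDerivAt Gd Gdd (δ w)` in addition,
`V″ ∘ δd w = (compL (lam w)) ∘ Gdd ∘ δd w + (compL.flip (Gd (δ w))) ∘ lam′` — both sides are derivatives at `w` of
`w′ ↦ DV(δ w′) = λ(w′) ∘ Gd(δ w′)` (chain rule on the left; the product rule `HasFDerivAt.clm_comp` on the right), equal on `s`. [folklore] -/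
theorem hessian_chain_eq_kkt_deriv (hs : s ∈ 𝓝 w) (hδ : ∀ w' ∈ s, HasFDerivAt δ (δd w') w')
    (hkkt : ∀ w' ∈ s, fderiv ℝ V (δ w') = (lam w').comp (Gd (δ w')))
    {lam' : F →L[ℝ] F →L[ℝ] ℝ} (hlam : HasFDerivAt lam lam' w)
    {V'' : E →L[ℝ] E →L[ℝ] ℝ} (hV2 : HasFDerivAt (fderiv ℝ V) V'' (δ w))
    {Gdd : E →L[ℝ] E →L[ℝ] F} (hGdd : HasFDerivAt Gd Gdd (δ w)) :
    V''.comp (δd w) =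
      ((ContinuousLinearMap.compL ℝ E F ℝ) (lam w)).comp (Gdd.comp (δd w)) +
        (((ContinuousLinearMap.compL ℝ E F ℝ).flip (Gd (δ w))).comp lam') := by
  have hw : w ∈ s := mem_of_mem_nhds hs
  -- left: `w′ ↦ fderiv V (δ w′)` by the chain rule
  have hL : HasFDerivAt (fun w' => fderiv ℝ V (δ w')) (V''.comp (δd w)) w := hV2.comp w (hδ w hw)
  -- right: `w′ ↦ (lam w′).comp (Gd (δ w′))` by the product rule for `comp`
  have hGdδ : HasFDerivAt (fun w' => Gd (δ w')) (Gdd.comp (δd w)) w := hGdd.comp w (hδ w hw)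
  have hR : HasFDerivAt (fun w' => (lam w').comp (Gd (δ w')))
      (((ContinuousLinearMap.compL ℝ E F ℝ) (lam w)).comp (Gdd.comp (δd w)) +
        (((ContinuousLinearMap.compL ℝ E F ℝ).flip (Gd (δ w))).comp lam')) w :=
    hlam.clm_comp hGdδ
  -- the two functions agree on `s`
  have heq : (fun w' => (lam w').comp (Gd (δ w'))) =ᶠ[𝓝 w] fun w' => fderiv ℝ V (δ w') := by
    filter_upwards [hs] with w' hw'
    exact (hkkt w' hw').symm
  exact hL.unique (hR.congr_of_eventuallyEq heq.symm)

/-- **THE GRAPH FORMULA FOR THE MULTIPLIER's DERIVATIVE**: under the letters of §3 plus `HasFDerivAt (fderiv V) V″ (δ w)`,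
`HasFDerivAt Gd Gdd (δ w)` and the constraint near `w`,
`lam′ k k′ = (V″ − (compL (lam w)) ∘ Gdd) (δd w k) (δd w k′)` = `V″(δ′k)(δ′k′) − λ(w)(G″(δ′k)(δ′k′))` — the LAGRANGIAN form
(ALE ∕ HKB's `P₀ − postcomp λ₀ ∘ C₀`, here at the moving point `δ w` with the moving multiplier `λ(w)`) on the graph directions:
test the differentiated KKT identity on `δd w k′` and use `Gd (δ w) (δd w k′) = k′` (§1). [folklore] -/
theorem lagrangian_graph_formula (hs : s ∈ 𝓝 w) (hGδ : ∀ w' ∈ s, G (δ w') = w')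
    (hG : ∀ w' ∈ s, HasFDerivAt G (Gd (δ w')) (δ w')) (hδ : ∀ w' ∈ s, HasFDerivAt δ (δd w') w')
    (hkkt : ∀ w' ∈ s, fderiv ℝ V (δ w') = (lam w').comp (Gd (δ w')))
    {lam' : F →L[ℝ] F →L[ℝ] ℝ} (hlam : HasFDerivAt lam lam' w)
    {V'' : E →L[ℝ] E →L[ℝ] ℝ} (hV2 : HasFDerivAt (fderiv ℝ V) V'' (δ w))
    {Gdd : E →L[ℝ] E →L[ℝ] F} (hGdd : HasFDerivAt Gd Gdd (δ w)) (k k' : F) :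
    lam' k k' = (V'' - ((ContinuousLinearMap.compL ℝ E F ℝ) (lam w)).comp Gdd) (δd w k) (δd w k') := by
  have hw : w ∈ s := mem_of_mem_nhds hs
  have hid : Gd (δ w) (δd w k') = k' := apply_branchDeriv hs hGδ (hG w hw) (hδ w hw) k'
  have h := congrArg (fun T : F →L[ℝ] E →L[ℝ] ℝ => T k (δd w k'))
    (hessian_chain_eq_kkt_deriv hs hδ hkkt hlam hV2 hGdd)
  simp only [ContinuousLinearMap.comp_apply, add_apply, ContinuousLinearMap.compL_apply,
    ContinuousLinearMap.flip_apply, hid] at h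
  rw [sub_apply, sub_apply, ContinuousLinearMap.comp_apply, ContinuousLinearMap.compL_apply,
    ContinuousLinearMap.comp_apply]
  linarith

/-- **THE GRAPH FORMULA FOR THE NEXT HESSIAN**: `(V ∘ δ)″(w) k k′ = (V″ − λ(w) ∘ G″)(δ′k)(δ′k′)`. [folklore] -/
theorem hessian_comp_kktBranch_apply (hs : s ∈ 𝓝 w) (hGδ : ∀ w' ∈ s, G (δ w') = w')
    (hG : ∀ w' ∈ s, HasFDerivAt G (Gd (δ w')) (δ w')) (hδ : ∀ w' ∈ s, HasFDerivAt δ (δd w') w')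
    (hV : ∀ w' ∈ s, DifferentiableAt ℝ V (δ w')) (hkkt : ∀ w' ∈ s, fderiv ℝ V (δ w') = (lam w').comp (Gd (δ w')))
    {lam' : F →L[ℝ] F →L[ℝ] ℝ} (hlam : HasFDerivAt lam lam' w)
    {V'' : E →L[ℝ] E →L[ℝ] ℝ} (hV2 : HasFDerivAt (fderiv ℝ V) V'' (δ w))
    {Gdd : E →L[ℝ] E →L[ℝ] F} (hGdd : HasFDerivAt Gd Gdd (δ w)) (k k' : F) :
    fderiv ℝ (fderiv ℝ (V ∘ δ)) w k k' =
      (V'' - ((ContinuousLinearMap.compL ℝ E F ℝ) (lam w)).comp Gdd) (δd w k) (δd w k') := by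
  rw [fderiv_fderiv_comp_kktBranch hs hGδ hG hδ hV hkkt hlam]
  exact lagrangian_graph_formula hs hGδ hG hδ hkkt hlam hV2 hGdd k k'

/-! ## §5. Two-sided letters for the next scale: floor `m∕q²` and bound `‖𝓛‖·‖δ′‖²` -/

/-- **THE NEXT SCALE's FLOOR FROM THE LAGRANGIAN FLOOR ON GRAPH DIRECTIONS**: `m‖δ′k‖² ≤ 𝓛 (δ′k) (δ′k)` for all `k`
(`𝓛 = V″ − λ(w) ∘ G″`), `0 ≤ m`, `0 < q`, `‖Gd (δ w) x‖ ≤ q‖x‖` ⟹ `(m∕q²)‖k‖² ≤ (V ∘ δ)″(w) k k` (as `k = Gd(δ′k)`). [folklore] -/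
theorem floor_hessian_comp_kktBranch (hs : s ∈ 𝓝 w) (hGδ : ∀ w' ∈ s, G (δ w') = w')
    (hG : ∀ w' ∈ s, HasFDerivAt G (Gd (δ w')) (δ w')) (hδ : ∀ w' ∈ s, HasFDerivAt δ (δd w') w')
    (hV : ∀ w' ∈ s, DifferentiableAt ℝ V (δ w')) (hkkt : ∀ w' ∈ s, fderiv ℝ V (δ w') = (lam w').comp (Gd (δ w')))
    {lam' : F →L[ℝ] F →L[ℝ] ℝ} (hlam : HasFDerivAt lam lam' w)
    {V'' : E →L[ℝ] E →L[ℝ] ℝ} (hV2 : HasFDerivAt (fderiv ℝ V) V'' (δ w))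
    {Gdd : E →L[ℝ] E →L[ℝ] F} (hGdd : HasFDerivAt Gd Gdd (δ w))
    {m q : ℝ} (hm : 0 ≤ m) (hq : 0 < q) (hGq : ∀ x : E, ‖Gd (δ w) x‖ ≤ q * ‖x‖)
    (hfloor : ∀ k : F, m * ‖δd w k‖ ^ 2 ≤
      (V'' - ((ContinuousLinearMap.compL ℝ E F ℝ) (lam w)).comp Gdd) (δd w k) (δd w k)) (k : F) :
    m / q ^ 2 * ‖k‖ ^ 2 ≤ fderiv ℝ (fderiv ℝ (V ∘ δ)) w k k := by
  have hw : w ∈ s := mem_of_mem_nhds hs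
  have hk : ‖k‖ ≤ q * ‖δd w k‖ := norm_le_mul_norm_branchDeriv hs hGδ (hG w hw) (hδ w hw) hGq k
  have hk2 : ‖k‖ ^ 2 ≤ q ^ 2 * ‖δd w k‖ ^ 2 := by
    rw [← mul_pow]
    exact pow_le_pow_left₀ (norm_nonneg _) hk 2
  calc m / q ^ 2 * ‖k‖ ^ 2 ≤ m / q ^ 2 * (q ^ 2 * ‖δd w k‖ ^ 2) :=
        mul_le_mul_of_nonneg_left hk2 (by positivity)
    _ = m * ‖δd w k‖ ^ 2 := by field_simp
    _ ≤ (V'' - ((ContinuousLinearMap.compL ℝ E F ℝ) (lam w)).comp Gdd) (δd w k) (δd w k) := hfloor k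
    _ = fderiv ℝ (fderiv ℝ (V ∘ δ)) w k k :=
        (hessian_comp_kktBranch_apply hs hGδ hG hδ hV hkkt hlam hV2 hGdd k k).symm

/-- **THE NEXT SCALE's HESSIAN BOUND**: `‖(V ∘ δ)″(w)‖ ≤ ‖V″ − λ(w) ∘ G″‖·‖δ′(w)‖²` (HKB: `‖δ′(w)‖ ≤ ‖fst‖·(N′⁻¹ − c)⁻¹`). [folklore] -/
theorem norm_hessian_comp_kktBranch_le (hs : s ∈ 𝓝 w) (hGδ : ∀ w' ∈ s, G (δ w') = w')
    (hG : ∀ w' ∈ s, HasFDerivAt G (Gd (δ w')) (δ w')) (hδ : ∀ w' ∈ s, HasFDerivAt δ (δd w') w')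
    (hV : ∀ w' ∈ s, DifferentiableAt ℝ V (δ w')) (hkkt : ∀ w' ∈ s, fderiv ℝ V (δ w') = (lam w').comp (Gd (δ w')))
    {lam' : F →L[ℝ] F →L[ℝ] ℝ} (hlam : HasFDerivAt lam lam' w)
    {V'' : E →L[ℝ] E →L[ℝ] ℝ} (hV2 : HasFDerivAt (fderiv ℝ V) V'' (δ w))
    {Gdd : E →L[ℝ] E →L[ℝ] F} (hGdd : HasFDerivAt Gd Gdd (δ w)) :
    ‖fderiv ℝ (fderiv ℝ (V ∘ δ)) w‖ ≤ ‖V'' - ((ContinuousLinearMap.compL ℝ E F ℝ) (lam w)).comp Gdd‖ * ‖δd w‖ ^ 2 := by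
  set L : E →L[ℝ] E →L[ℝ] ℝ := V'' - ((ContinuousLinearMap.compL ℝ E F ℝ) (lam w)).comp Gdd with hL
  refine ContinuousLinearMap.opNorm_le_bound _ (by positivity) fun k => ?_
  refine ContinuousLinearMap.opNorm_le_bound _ (by positivity) fun k' => ?_
  rw [hessian_comp_kktBranch_apply hs hGδ hG hδ hV hkkt hlam hV2 hGdd k k', ← hL]
  calc ‖L (δd w k) (δd w k')‖ ≤ ‖L (δd w k)‖ * ‖δd w k'‖ := ContinuousLinearMap.le_opNorm _ _
    _ ≤ ‖L‖ * ‖δd w k‖ * (‖δd w‖ * ‖k'‖) :=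
        mul_le_mul (ContinuousLinearMap.le_opNorm _ _) (ContinuousLinearMap.le_opNorm _ _) (norm_nonneg _)
          (mul_nonneg (norm_nonneg L) (norm_nonneg (δd w k)))
    _ ≤ ‖L‖ * (‖δd w‖ * ‖k‖) * (‖δd w‖ * ‖k'‖) := by
        gcongr
        exact ContinuousLinearMap.le_opNorm _ _
    _ = ‖L‖ * ‖δd w‖ ^ 2 * ‖k‖ * ‖k'‖ := by ring

end SecondOrder

/-! ## §6. In HKB's conclusion shape: a primal–dual branch `σ = (δ, λ)` on an open ball with zero KKT residual -/

/-- **THE VALUE SIDE OF HKB's KKT BRANCH.**  Let `σ : F → E × (F →L ℝ)` satisfy on `ball c ρ`: the constraint `G (σ w′).1 = w′`,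
ZERO KKT residual `fderiv V (σ w′).1 = (σ w′).2 ∘ Gd (σ w′).1` (HKB's frozen residual at a KKT base point), `HasFDerivAt σ (S w′) w′`
(HKB: `S w′ = A_{w′}⁻¹ ∘ inl`), `HasFDerivAt G (Gd (σ w′).1) (σ w′).1`, `DifferentiableAt V (σ w′).1`.  Then at every `w ∈ ball c ρ`:
(i) `HasFDerivAt (V ∘ (σ ·).1) (σ w).2 w` (the multiplier component is the gradient of the next action) and
(ii) `HasFDerivAt (fderiv (V ∘ (σ ·).1)) (snd ∘ S w) w` (the next Hessian is the dual block row of the branch derivative). [folklore] -/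
theorem hasFDerivAt_fderiv_value_of_kktBranch {G : E → F} {V : E → ℝ} {Gd : E → E →L[ℝ] F}
    {σ : F → E × (F →L[ℝ] ℝ)} {S : F → F →L[ℝ] (E × (F →L[ℝ] ℝ))} {c : F} {ρ : ℝ}
    (hGσ : ∀ w' ∈ ball c ρ, G (σ w').1 = w')
    (hres : ∀ w' ∈ ball c ρ, fderiv ℝ V (σ w').1 = (σ w').2.comp (Gd (σ w').1))
    (hσ : ∀ w' ∈ ball c ρ, HasFDerivAt σ (S w') w')
    (hG : ∀ w' ∈ ball c ρ, HasFDerivAt G (Gd (σ w').1) (σ w').1)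
    (hV : ∀ w' ∈ ball c ρ, DifferentiableAt ℝ V (σ w').1) {w : F} (hw : w ∈ ball c ρ) :
    HasFDerivAt (V ∘ fun w' => (σ w').1) (σ w).2 w ∧
      HasFDerivAt (fderiv ℝ (V ∘ fun w' => (σ w').1))
        ((ContinuousLinearMap.snd ℝ E (F →L[ℝ] ℝ)).comp (S w)) w := by
  have hs : ball c ρ ∈ 𝓝 w := isOpen_ball.mem_nhds hw
  -- the two components of the branch and their derivatives
  have hδ : ∀ w' ∈ ball c ρ, HasFDerivAt (fun w'' => (σ w'').1)
      ((ContinuousLinearMap.fst ℝ E (F →L[ℝ] ℝ)).comp (S w')) w' :=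
    fun w' hw' => (ContinuousLinearMap.fst ℝ E (F →L[ℝ] ℝ)).hasFDerivAt.comp w' (hσ w' hw')
  have hlam : HasFDerivAt (fun w'' => (σ w'').2) ((ContinuousLinearMap.snd ℝ E (F →L[ℝ] ℝ)).comp (S w)) w :=
    (ContinuousLinearMap.snd ℝ E (F →L[ℝ] ℝ)).hasFDerivAt.comp w (hσ w hw)
  refine ⟨?_, ?_⟩
  · exact hasFDerivAt_comp_kktBranch (lam := fun w'' => (σ w'').2) hs hGσ (hG w hw) (hδ w hw) (hV w hw) (hres w hw)
  · exact hasFDerivAt_fderiv_comp_kktBranch (lam := fun w'' => (σ w'').2) (Gd := Gd) hs hGσ hG hδ hV hres hlam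

/-- … and the graph formula in the same shape: with `HasFDerivAt (fderiv V) V″ (σ w).1` and `HasFDerivAt Gd Gdd (σ w).1`,
`(V ∘ (σ ·).1)″(w) k k′ = (V″ − (σ w).2 ∘ Gdd) ((fst ∘ S w) k) ((fst ∘ S w) k′)`. [folklore] -/
theorem hessian_value_of_kktBranch_apply {G : E → F} {V : E → ℝ} {Gd : E → E →L[ℝ] F}
    {σ : F → E × (F →L[ℝ] ℝ)} {S : F → F →L[ℝ] (E × (F →L[ℝ] ℝ))} {c : F} {ρ : ℝ}
    (hGσ : ∀ w' ∈ ball c ρ, G (σ w').1 = w')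
    (hres : ∀ w' ∈ ball c ρ, fderiv ℝ V (σ w').1 = (σ w').2.comp (Gd (σ w').1))
    (hσ : ∀ w' ∈ ball c ρ, HasFDerivAt σ (S w') w')
    (hG : ∀ w' ∈ ball c ρ, HasFDerivAt G (Gd (σ w').1) (σ w').1)
    (hV : ∀ w' ∈ ball c ρ, DifferentiableAt ℝ V (σ w').1) {w : F} (hw : w ∈ ball c ρ)
    {V'' : E →L[ℝ] E →L[ℝ] ℝ} (hV2 : HasFDerivAt (fderiv ℝ V) V'' (σ w).1)
    {Gdd : E →L[ℝ] E →L[ℝ] F} (hGdd : HasFDerivAt Gd Gdd (σ w).1) (k k' : F) :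
    fderiv ℝ (fderiv ℝ (V ∘ fun w' => (σ w').1)) w k k' =
      (V'' - ((ContinuousLinearMap.compL ℝ E F ℝ) (σ w).2).comp Gdd)
        (((ContinuousLinearMap.fst ℝ E (F →L[ℝ] ℝ)).comp (S w)) k)
        (((ContinuousLinearMap.fst ℝ E (F →L[ℝ] ℝ)).comp (S w)) k') := by
  have hs : ball c ρ ∈ 𝓝 w := isOpen_ball.mem_nhds hw
  have hδ : ∀ w' ∈ ball c ρ, HasFDerivAt (fun w'' => (σ w'').1)
      ((ContinuousLinearMap.fst ℝ E (F →L[ℝ] ℝ)).comp (S w')) w' :=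
    fun w' hw' => (ContinuousLinearMap.fst ℝ E (F →L[ℝ] ℝ)).hasFDerivAt.comp w' (hσ w' hw')
  have hlam : HasFDerivAt (fun w'' => (σ w'').2) ((ContinuousLinearMap.snd ℝ E (F →L[ℝ] ℝ)).comp (S w)) w :=
    (ContinuousLinearMap.snd ℝ E (F →L[ℝ] ℝ)).hasFDerivAt.comp w (hσ w hw)
  exact hessian_comp_kktBranch_apply (lam := fun w'' => (σ w'').2) (Gd := Gd) (δd := fun w' =>
    (ContinuousLinearMap.fst ℝ E (F →L[ℝ] ℝ)).comp (S w')) hs hGσ hG hδ hV hres hlam hV2 hGdd k k'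

/-! ## §7. Toys -/

/-- Toy for §1: on `ℝ`, the constraint `G = id` with the branch `δ = id` (`G ∘ δ = id` everywhere): `Gd = δd = 1` and `1 ∘ 1 = 1`. -/
example : (ContinuousLinearMap.id ℝ ℝ).comp (ContinuousLinearMap.id ℝ ℝ) = ContinuousLinearMap.id ℝ ℝ :=
  comp_branchDeriv_eq_id (G := id) (δ := id) (s := univ) (w := 0) univ_mem (fun _ _ => rfl) (hasFDerivAt_id _)
    (hasFDerivAt_id _)

/-- Toy for §3: `E = F = ℝ`, `G = δ = id`, `V = 0`, `λ = 0` (the KKT identity `D0 = 0 ∘ 1` holds everywhere), `λ′ = 0`: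
the next action `0 ∘ id` has Hessian `0` at `0`. -/
example : HasFDerivAt (fderiv ℝ ((fun _ : ℝ => (0 : ℝ)) ∘ id)) (0 : ℝ →L[ℝ] ℝ →L[ℝ] ℝ) (0 : ℝ) := by
  refine hasFDerivAt_fderiv_comp_kktBranch (G := id) (δ := id) (lam := fun _ => (0 : ℝ →L[ℝ] ℝ))
    (Gd := fun _ => ContinuousLinearMap.id ℝ ℝ) (δd := fun _ => ContinuousLinearMap.id ℝ ℝ) (s := univ)
    univ_mem (fun _ _ => rfl) (fun _ _ => hasFDerivAt_id _) (fun _ _ => hasFDerivAt_id _)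
    (fun _ _ => differentiableAt_const _) (fun w' _ => ?_) (hasFDerivAt_const _ _)
  have h : fderiv ℝ (fun _ : ℝ => (0 : ℝ)) = fun _ => 0 := by
    ext x
    simp
  rw [h]
  simp

end Summit.QuantumFields.BalabanUV.T4Continuum.NE7b.HardStepKKTActionHessian

end
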